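import Summits.QuantumAdvantage.QuantumAdvantage.Theorems.CubicForrelationNearExactIsExactLadderSummaryB
import Summits.QuantumAdvantage.QuantumAdvantage.Theorems.CubicForrelationNearExactIsExactTwelveTheta5764
import Summits.QuantumAdvantage.QuantumAdvantage.Theorems.NearExactIsExact.Negative.ThetaFourteenSixtyOne
import Summits.QuantumAdvantage.QuantumAdvantage.Theorems.NearExactIsExact.Negative.SixtyOneNotAttainedFourteen
import Summits.QuantumAdvantage.QuantumAdvantage.Theorems.NearExactIsExact.Negative.TypeOOneTwentyOneFourteen

/-!
# Crux `CubicForrelation.NearExactIsExact` (stmt-QuantumAdvantage-14043) — the certified `θ_n` ladder, index REFRESH (2026-08-26, after gen 43)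

Certificate seat `b2b-cforr-cert` (gen 44).  HONEST FRAMING: this file adds NO new mathematics.  It re-packages the tables of
`…LadderSummary.lean` (gen 11) and `…LadderSummaryB.lean` (gen 15) with the two rows that have moved since, so that ONE file states exactly
what is proved at which `n` today: **`n = 12`** (the sharp constant is now KNOWN: `θ₁₂ = 57/64`, gens 36–43, `theta_twelve_eq_57_64`) and
**`n = 14`** (window narrowed to `[57/64, 61/64)`, `61/64` not attained, a type-O side caps at `121/128`; disprover gens 23–25).
NOT summit progress: the crux asks for ONE `θ < 1` uniform in `n`; every finite-slice bound tends to `1` and `θ_n ≥ 15/16` for `n ≥ 16`.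

| `n` | verdict (all kernel-checked, standard axioms) | deciding declarations |
|-----|-----------------------------------------------|------------------------|
| `2, 4, 6, 8, 10` | `θ₂ = 1/2`ᶜ, `θ₄ = 3/4`ᶜ, `θ₆ = 25/32`ᶜ, `θ₈ = 13/16`, `θ₁₀ = 7/8` | `…LadderSummary.ls_ladder_exact_rows` (ᶜ = compiled certificate), `theta_ten_isLeast` |
| `12` | **`θ₁₂ = 57/64` EXACTLY** (attained by the `𝔽₈`-chain pair; nothing in `(57/64, 1)`) | `theta_twelve_eq_57_64` (…TwelveTheta5764, gen 43: `= theta_twelve_eq_57_64_of_R4 tpw_HR4`, the E1280-even programme …CubicForm*) |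
| `14` | **`θ₁₄ ∈ [57/64, 61/64)`**: `Φ ≥ 61/64 ⇒ Φ = 1`; a TYPE-O side (`W_g = 32u`, `u` odd) forces `Φ ≤ 121/128`; a BENT side forces `Φ ∈ {1} ∪ [≤ 29/32]` in Lean (`fo_bent_false`) and `≤ 7/8` on paper (DISPROOF §18 BENT14); open: is any value in `(57/64, 61/64)` attained? (configurations: DISPROOF §32.4) | `Negative.ThetaFourteenSixtyOne.theta_fourteen_window_61`, `Negative.SixtyOneNotAttainedFourteen.ge_61_is_exact`, `.exists_theta_lt_61_fourteen`, `Negative.TypeOOneTwentyOneFourteen.typeO_forrelation_le_121_fin14`, record `Negative.ProductFourteen` (`57/64`) |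
| `16 … 30` | unchanged windows `[15/16, 31/32)`, `[15/16, 63/64)`, `[15/16, 127/128)` (×2), `[15/16, 255/256)`, `[15/16, 511/512)` (×2), `[15/16, 1023/1024)` | `…LadderSummary.ls_ladder_windows` |
| all even `n` | `θ_n` exists, is non-decreasing, `≤ 1 − 2^{−⌊n/3⌋−1}` (`n ≥ 6`), `≥ 15/16` (`n ≥ 16`); the crux is a tail statement | `…LadderEnvelope` (`theta_mono`, `isolation_rate_even`, `nearExactIsExact_iff_eventually`), `ls_ladder_uniform` |

WHAT IS OPEN (finite slices): `θ₁₄` (31·2 … candidate values in `(57/64, 61/64)`, granularity `2⁻¹⁶`; the structure brick for its three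
pending configurations is `kh_structure`, …KtHalfStructure, gen 44); every window from `n = 16` on; whether any cubic pair at any `n` has
`Φ ∈ (15/16, 1)`.

The theorems below are conjunctions / repackagings of cited declarations; axioms: `propext, Classical.choice, Quot.sound`.
-/

set_option linter.dupNamespace false -- D-0017: single-problem summit ⇒ `QuantumAdvantage.QuantumAdvantage` by design

noncomputable section

namespace Summit.QuantumAdvantage.QuantumAdvantage.Theorems.CubicForrelation.NearExactIsExact

open Finset
open Literature.Computability.QuantumComplexity
open Literature.Computability.QuantumComplexity.DerivativeWalsh (W)
open Summit.QuantumAdvantage.QuantumAdvantage.Theorems.NearExactIsExact.Negative.ThetaFourteenSixtyOne (theta_fourteen_window_61)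
open Summit.QuantumAdvantage.QuantumAdvantage.Theorems.NearExactIsExact.Negative.SixtyOneNotAttainedFourteen
  (ge_61_is_exact exists_theta_lt_61_fourteen)
open Summit.QuantumAdvantage.QuantumAdvantage.Theorems.NearExactIsExact.Negative.TypeOOneTwentyOneFourteen (typeO_forrelation_le_121_fin14)

/-! ### The refreshed rows -/

-- The row `n = 12` is the landed `theta_twelve_eq_57_64` itself (…TwelveTheta5764); it is re-used below, not restated.

/-- **The row `n = 14` (2026-08-26): `θ₁₄ ∈ [57/64, 61/64)`, the closed isolation `Φ ≥ 61/64 ⇒ Φ = 1`, and the type-O cap `121/128`**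
(for a pair whose `g`-spectrum is `32·u` with every `u(x)` odd, `Φ ≤ 121/128`).  Finite-slice verdicts; NOT summit progress. [this work] -/
theorem lsc_fourteen_row :
    (∃ θ₀ : ℝ, 57 / 64 ≤ θ₀ ∧ θ₀ < 61 / 64 ∧ IsLeast {θ : ℝ | ∀ f g : (Fin 14 → Bool) → Bool, IsDegLeFun 3 f → IsDegLeFun 3 g →
        θ < forrelation f g → forrelation f g = 1} θ₀) ∧
    (∀ f g : (Fin 14 → Bool) → Bool, IsDegLeFun 3 f → IsDegLeFun 3 g → (61 / 64 : ℝ) ≤ forrelation f g → forrelation f g = 1) ∧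
    (∀ f g : (Fin 14 → Bool) → Bool, IsDegLeFun 3 f → IsDegLeFun 3 g →
      ∀ u : (Fin 14 → Bool) → ℤ, (∀ x, W (fun y => signOf (g y)) x = (2 : ℝ) ^ 5 * (u x : ℝ)) → (∀ x, Odd (u x)) →
        forrelation f g ≤ 121 / 128) := by
  refine ⟨?_, fun f g hf hg h => ge_61_is_exact f g hf hg h, typeO_forrelation_le_121_fin14⟩
  obtain ⟨θ₀, h57, -, hleast⟩ := theta_fourteen_window_61
  obtain ⟨θ, hθ, hiso⟩ := exists_theta_lt_61_fourteen
  exact ⟨θ₀, h57, lt_of_le_of_lt (hleast.2 hiso) hθ, hleast⟩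

/-- **The certified rows and windows, refreshed (2026-08-26)**: `θ₁₂ = 57/64` (exact); `θ₁₄ ∈ [57/64, 61/64)`; `θ₁₆ ∈ [15/16, 31/32)`,
`θ₁₈ ∈ [15/16, 63/64)`, `θ₂₀, θ₂₂ ∈ [15/16, 127/128)`, `θ₂₄ ∈ [15/16, 255/256)`, `θ₂₆, θ₂₈ ∈ [15/16, 511/512)`, `θ₃₀ ∈ [15/16, 1023/1024)`.
None of the windows from `n = 14` on is decided.  NOT summit progress. [this work] -/
theorem lsc_ladder_windows :
    IsLeast {θ : ℝ | ∀ f g : (Fin 12 → Bool) → Bool, IsDegLeFun 3 f → IsDegLeFun 3 g →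
        θ < forrelation f g → forrelation f g = 1} (57 / 64) ∧
    (∃ θ₀ : ℝ, 57 / 64 ≤ θ₀ ∧ θ₀ < 61 / 64 ∧ IsLeast {θ : ℝ | ∀ f g : (Fin 14 → Bool) → Bool, IsDegLeFun 3 f → IsDegLeFun 3 g →
        θ < forrelation f g → forrelation f g = 1} θ₀) ∧
    (∃ θ₀ : ℝ, 15 / 16 ≤ θ₀ ∧ θ₀ < 31 / 32 ∧ IsLeast {θ : ℝ | ∀ f g : (Fin 16 → Bool) → Bool, IsDegLeFun 3 f → IsDegLeFun 3 g →
        θ < forrelation f g → forrelation f g = 1} θ₀) ∧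
    (∃ θ₀ : ℝ, 15 / 16 ≤ θ₀ ∧ θ₀ < 63 / 64 ∧ IsLeast {θ : ℝ | ∀ f g : (Fin 18 → Bool) → Bool, IsDegLeFun 3 f → IsDegLeFun 3 g →
        θ < forrelation f g → forrelation f g = 1} θ₀) ∧
    (∃ θ₀ : ℝ, 15 / 16 ≤ θ₀ ∧ θ₀ < 127 / 128 ∧ IsLeast {θ : ℝ | ∀ f g : (Fin 20 → Bool) → Bool, IsDegLeFun 3 f → IsDegLeFun 3 g →
        θ < forrelation f g → forrelation f g = 1} θ₀) ∧
    (∃ θ₀ : ℝ, 15 / 16 ≤ θ₀ ∧ θ₀ < 127 / 128 ∧ IsLeast {θ : ℝ | ∀ f g : (Fin 22 → Bool) → Bool, IsDegLeFun 3 f → IsDegLeFun 3 g →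
        θ < forrelation f g → forrelation f g = 1} θ₀) ∧
    (∃ θ₀ : ℝ, 15 / 16 ≤ θ₀ ∧ θ₀ < 255 / 256 ∧ IsLeast {θ : ℝ | ∀ f g : (Fin 24 → Bool) → Bool, IsDegLeFun 3 f → IsDegLeFun 3 g →
        θ < forrelation f g → forrelation f g = 1} θ₀) ∧
    (∃ θ₀ : ℝ, 15 / 16 ≤ θ₀ ∧ θ₀ < 511 / 512 ∧ IsLeast {θ : ℝ | ∀ f g : (Fin 26 → Bool) → Bool, IsDegLeFun 3 f → IsDegLeFun 3 g →
        θ < forrelation f g → forrelation f g = 1} θ₀) ∧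
    (∃ θ₀ : ℝ, 15 / 16 ≤ θ₀ ∧ θ₀ < 511 / 512 ∧ IsLeast {θ : ℝ | ∀ f g : (Fin 28 → Bool) → Bool, IsDegLeFun 3 f → IsDegLeFun 3 g →
        θ < forrelation f g → forrelation f g = 1} θ₀) ∧
    (∃ θ₀ : ℝ, 15 / 16 ≤ θ₀ ∧ θ₀ < 1023 / 1024 ∧ IsLeast {θ : ℝ | ∀ f g : (Fin 30 → Bool) → Bool, IsDegLeFun 3 f → IsDegLeFun 3 g →
        θ < forrelation f g → forrelation f g = 1} θ₀) :=
  ⟨theta_twelve_eq_57_64, lsc_fourteen_row.1, ls_ladder_windows.2.2⟩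

end Summit.QuantumAdvantage.QuantumAdvantage.Theorems.CubicForrelation.NearExactIsExact

end
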